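import Summits.HubbardSuperconductivity.HubbardSuperconductivity.Theorems.BalabanIRBirEveryGroundStateUniqueGroundClosers
import Summits.HubbardSuperconductivity.HubbardSuperconductivity.Theorems.JosephsonMirrorJmCuspFreeLayersNotSimple
import Summits.HubbardSuperconductivity.HubbardSuperconductivity.Theorems.JosephsonMirrorJmCuspHalfFilledSimple
import HarnessLib

/-!
# Route `BalabanIR`, crux 5 `BirEveryGroundState` (`stmt-HubbardSuperconductivity-2083`):
# the Lieb mirrors — AVERAGE ⇒ EVERY is a THEOREM on the accessible boundary of the crux's quadrant

Theses-free helper (`--supports stmt-HubbardSuperconductivity-2083`; no route file is imported,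
directly or transitively).

The crux asks, for doping `δ ∈ (0, 1/2)` and a window `(U₁, U₂) ⊂ (0, ∞)` of REPULSIVE couplings:
if at every `U` in the window the ground-eigenspace AVERAGE of `Δ_d† Δ_d` in the sector
`(N_L, S^z) = (2⌊(1-δ)L²/2⌋, 0)` of `hubbardTorus 2 L 1 U` is `≥ c L⁴` eventually in even `L`, then at
SOME `U` in the window EVERY normalised sector ground-state sequence has `d_{x²-y²}` pair-field
long-range order. Twenty-three lead seats found the step insulated: it needs a source-less rigidity
of the sector ground eigenspace (no `Δ_d† Δ_d`-dark ground direction, cofinitely in even `L`) that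
no printed theorem supplies for doped repulsive Hubbard tori.

This file records, as unconditional theorems, that the SAME step — with the crux's hypothesis and
conclusion bodies verbatim — HOLDS on the whole part of the boundary of the parameter quadrant
`{U > 0} × {0 < δ < 1/2}` that is accessible to theorems, because there the sector ground state is
eventually SIMPLE and a one-dimensional compression is scalar:

* `UniqueGround.finrank_groundEigenspace_eq_one_of_groundStates_smul` — pairwise proportionality
  of the sector ground states (the currency of Lieb's theorems in the tree) is `dim E₀(U, L) = 1`;
* `avgToEvery_at_of_eventualSimplicity` — at ONE coupling `U` (any sign) and any `δ ≥ -1`: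
  eventual simplicity of the sector ground state + the eventual average bound ⇒ the crux's
  conclusion body at `(U, δ)` (pigeonhole over an orthonormal frame,
  `UniqueGround.le_re_of_scalar_of_average`, then the socket `forall_hasLRO_iff_groundState_bound`);
* `avgToEvery_attractive`, `birEveryGroundState_attractiveMirror(_forall)` — the ATTRACTIVE mirror:
  for `U < 0` (Lieb's Theorem 1, in tree as `lieb_attractive_holds` /
  `JosephsonMirror.eventualSimplicity_attractive`) average ⇒ every holds at EVERY coupling, so the
  crux's statement with the window moved to `(U₁, U₂) ⊂ (-∞, 0)` is a theorem (at every, not just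
  some, coupling of the window);
* `avgToEvery_halfFilling`, `birEveryGroundState_halfFillingMirror(_forall)` — the HALF-FILLED
  mirror: at the excluded endpoint `δ = 0` of the doping range and every `U > 0` (Lieb's Theorem 2
  on the balanced bipartite even torus, in tree as `lieb_repulsive_halfFilling_holds` /
  `JosephsonMirror.eventualSimplicity_halfFilling`) average ⇒ every holds, so the crux's statement
  at `δ = 0` is a theorem for every repulsive window.

Calibration: the crux's transfer is TRUE on `{U < 0}` and on `{δ = 0, U > 0}`; at `U = 0` simplicity
fails for every `0 < δ < 1` (open free shells, `JosephsonMirror.not_eventualSimplicity_free`), and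
the interior `{U > 0, 0 < δ < 1/2}` — the crux — is exactly where no simplicity / isotypic-purity
theorem exists. Sources: E. H. Lieb, *Two theorems on the Hubbard model*, Phys. Rev. Lett. 62 (1989)
1201, Theorems 1 and 2 (both proved in the tree); Scalapino, Phys. Rep. 250 (1995) 329, §2 for the
pair-field functional. Everything is folklore given those; no definition and no named fact is
introduced.
-/

noncomputable section

namespace Summit.HubbardSuperconductivity.HubbardSuperconductivity.Theorems

open Matrix Finset Filter
open Literature.Probability.LatticeModels Literature.MathematicalPhysics.QuantumLattice
open scoped ComplexOrder

/-! ### Simplicity in the tree's two currencies -/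

/-- **Pairwise proportional sector ground states span a line.** If any two ground states of
`hubbardTorus 2 L 1 U` in the joint sector `(2n, S^z = 0)`, `n ≤ L²`, are proportional (the
conclusion shape of Lieb's theorems in the tree), then the sector ground eigenspace
`szSector (2n) 0 ⊓ eigenspace (H, minEnergyOn H (szSector (2n) 0))` has dimension exactly `1`: it
contains a normalised sector ground state (`exists_unit_isGroundStateInSector_hubbardTorus`) and its
nonzero vectors are sector ground states. Lieb, PRL 62 (1989) 1201. [folklore] -/
theorem UniqueGround.finrank_groundEigenspace_eq_one_of_groundStates_smul (U : ℝ) (L n : ℕ)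
    (hn : n ≤ L ^ 2)
    (hsmul : ∀ φ φ' : Fock (Orb (FermionTorus 2 L)),
      IsGroundStateInSector (hubbardTorus 2 L 1 U) (2 * n) 0 φ →
        IsGroundStateInSector (hubbardTorus 2 L 1 U) (2 * n) 0 φ' → ∃ a : ℂ, φ' = a • φ) :
    Module.finrank ℂ ↥(szSector (Λ := FermionTorus 2 L) (2 * n) 0 ⊓
      Module.End.eigenspace (Matrix.toLin' (hubbardTorus 2 L 1 U))
        ((((hubbardTorus 2 L 1 U).minEnergyOn (szSector (Λ := FermionTorus 2 L) (2 * n) 0) : ℝ) :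
          ℂ))) = 1 := by
  set H : Matrix (Finset (Orb (FermionTorus 2 L))) (Finset (Orb (FermionTorus 2 L))) ℂ :=
    hubbardTorus 2 L 1 U with hH
  set S : Submodule ℂ (Fock (Orb (FermionTorus 2 L))) :=
    szSector (Λ := FermionTorus 2 L) (2 * n) 0 with hS
  set E₀ : Submodule ℂ (Fock (Orb (FermionTorus 2 L))) :=
    S ⊓ Module.End.eigenspace (Matrix.toLin' H) ((H.minEnergyOn S : ℝ) : ℂ) with hE₀
  have hmem : ∀ v : Fock (Orb (FermionTorus 2 L)),
      v ∈ E₀ ↔ v ∈ S ∧ H *ᵥ v = ((H.minEnergyOn S : ℝ) : ℂ) • v := by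
    intro v
    rw [hE₀, Submodule.mem_inf, Module.End.mem_eigenspace_iff, Matrix.toLin'_apply]
  -- a normalised sector ground state exists
  obtain ⟨ψ, -, hgs⟩ :=
    Literature.Barriers.HubbardSuperconductivity.exists_unit_isGroundStateInSector_hubbardTorus U L n hn
  have hψE : ψ ∈ E₀ := (hmem ψ).2 ⟨hgs.1, hgs.2.2⟩
  have hψE0 : (⟨ψ, hψE⟩ : ↥E₀) ≠ 0 := fun h => hgs.2.1 (congrArg Subtype.val h)
  refine (finrank_eq_one_iff_of_nonzero' (⟨ψ, hψE⟩ : ↥E₀) hψE0).2 ?_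
  rintro ⟨w, hw⟩
  by_cases hw0 : w = 0
  · refine ⟨0, Subtype.ext ?_⟩
    change (0 : ℂ) • ψ = w
    rw [zero_smul, hw0]
  · have hwgs : IsGroundStateInSector H (2 * n) 0 w :=
      ⟨((hmem w).1 hw).1, hw0, ((hmem w).1 hw).2⟩
    obtain ⟨a, ha⟩ := hsmul ψ w hgs hwgs
    refine ⟨a, Subtype.ext ?_⟩
    change a • ψ = w
    exact ha.symm

/-! ### AVERAGE ⇒ EVERY at one coupling, from eventual simplicity -/

/-- **Average ⇒ every at one coupling with eventually simple sector ground states.** Fix a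
coupling `U` (any sign) and `δ ≥ -1`. If, eventually in even `L`, any two ground states of
`hubbardTorus 2 L 1 U` in the sector `(2⌊(1-δ)L²/2⌋, S^z = 0)` are proportional (`hsimple`), and the
ground-eigenspace AVERAGE of `Δ_d† Δ_d` obeys the crux's bound `c L⁴ · re tr P ≤ re tr (P Δ_d† Δ_d)`
eventually in even `L` (`havg`, the crux's hypothesis body at `U`), then the crux's CONCLUSION body
holds at `(U, δ)`: every admissible normalised sector ground-state sequence has `d_{x²-y²}`
pair-field long-range order along even sides. Proof: at a large even side the ground eigenspace is a
line (`finrank_groundEigenspace_eq_one_of_groundStates_smul`), the compression of `Δ_d† Δ_d` to a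
line is scalar (`UniqueGround.exists_scalar_of_finrank_one`), pigeonhole over an orthonormal frame
turns the average bound into `c L⁴ ≤ re ⟨ψ, Δ_d† Δ_d ψ⟩` for every normalised ground state
(`UniqueGround.le_re_of_scalar_of_average`), and `forall_hasLRO_iff_groundState_bound` (⇐)
concludes. Scalapino, Phys. Rep. 250 (1995) 329, §2. [folklore] -/
theorem avgToEvery_at_of_eventualSimplicity (U δ c : ℝ) (hδ : -1 ≤ δ) (hc : 0 < c)
    (hsimple : ∃ L₀ : ℕ, ∀ (L : ℕ), Even L → L₀ ≤ L →
      ∀ φ φ' : Fock (Orb (FermionTorus 2 L)),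
        IsGroundStateInSector (hubbardTorus 2 L 1 U) (2 * ⌊(1 - δ) * (L : ℝ) ^ 2 / 2⌋₊) 0 φ →
          IsGroundStateInSector (hubbardTorus 2 L 1 U) (2 * ⌊(1 - δ) * (L : ℝ) ^ 2 / 2⌋₊) 0 φ' →
            ∃ a : ℂ, φ' = a • φ)
    (havg : ∃ L₀ : ℕ, ∀ (L : ℕ) [NeZero L], L₀ ≤ L → Even L →
      let N : ℕ := 2 * ⌊(1 - δ) * (L : ℝ) ^ 2 / 2⌋₊
      let H := hubbardTorus 2 L 1 U
      let S := szSector (Λ := FermionTorus 2 L) N 0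
      let E₀ := S ⊓ Module.End.eigenspace (Matrix.toLin' H) ((H.minEnergyOn S : ℝ) : ℂ)
      let P := projMatrix (E₀.map (Fock.toEuclidean (ι := Orb (FermionTorus 2 L)) :
        Fock (Orb (FermionTorus 2 L)) →ₗ[ℂ] EuclideanSpace ℂ (Finset (Orb (FermionTorus 2 L)))))
      c * (L : ℝ) ^ 4 * P.trace.re ≤
        (P * ((pairField dWaveFormFactor L)ᴴ * pairField dWaveFormFactor L)).trace.re) :
    ∀ (N : ℕ → ℕ) (ψ : ∀ L, Fock (Orb (FermionTorus 2 L))),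
      (∀ L, Even L → N L = 2 * ⌊(1 - δ) * (L : ℝ) ^ 2 / 2⌋₊ ∧ star (ψ L) ⬝ᵥ ψ L = 1 ∧
        IsGroundStateInSector (hubbardTorus 2 L 1 U) (N L) 0 (ψ L)) →
      HasLongRangeOrder (fun k => halfOpenBox 2 (2 * k))
        (fun k => torusPullback (pairFieldCorr dWaveFormFactor ψ) (2 * k)) := by
  obtain ⟨L₁, hL₁⟩ := hsimple
  obtain ⟨L₂, hL₂⟩ := havg
  refine (forall_hasLRO_iff_groundState_bound U δ hδ).2
    ⟨c, hc, max L₁ L₂, fun L _ hL hLe ψ hgs hunit => ?_⟩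
  have hL1 : L₁ ≤ L := (le_max_left _ _).trans hL
  have hL2 : L₂ ≤ L := (le_max_right _ _).trans hL
  -- the objects of side `L`
  set A : Matrix (Finset (Orb (FermionTorus 2 L))) (Finset (Orb (FermionTorus 2 L))) ℂ :=
    (pairField dWaveFormFactor L)ᴴ * pairField dWaveFormFactor L with hA
  set H : Matrix (Finset (Orb (FermionTorus 2 L))) (Finset (Orb (FermionTorus 2 L))) ℂ :=
    hubbardTorus 2 L 1 U with hH
  set S : Submodule ℂ (Fock (Orb (FermionTorus 2 L))) :=
    szSector (Λ := FermionTorus 2 L) (2 * ⌊(1 - δ) * (L : ℝ) ^ 2 / 2⌋₊) 0 with hS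
  set E₀ : Submodule ℂ (Fock (Orb (FermionTorus 2 L))) :=
    S ⊓ Module.End.eigenspace (Matrix.toLin' H) ((H.minEnergyOn S : ℝ) : ℂ) with hE₀
  -- simplicity at side `L`: the ground eigenspace is a line
  have hfin : Module.finrank ℂ E₀ = 1 :=
    UniqueGround.finrank_groundEigenspace_eq_one_of_groundStates_smul U L _
      (Literature.Barriers.HubbardSuperconductivity.natFloor_filling_le_sq hδ L) (hL₁ L hLe hL1)
  -- the ground state `ψ` lies in `E₀`
  obtain ⟨hψS, -, hHψ⟩ := hgs
  have hψE : ψ ∈ E₀ := by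
    refine Submodule.mem_inf.mpr ⟨hψS, ?_⟩
    rw [Module.End.mem_eigenspace_iff, Matrix.toLin'_apply]
    exact hHψ
  -- the average bound at side `L`
  have havgL := hL₂ L hL2 hLe
  simp only at havgL
  have hmap : E₀.map (Fock.toEuclidean (ι := Orb (FermionTorus 2 L)) :
      Fock (Orb (FermionTorus 2 L)) →ₗ[ℂ] EuclideanSpace ℂ (Finset (Orb (FermionTorus 2 L)))) =
      E₀.map ((WithLp.linearEquiv 2 ℂ (Finset (Orb (FermionTorus 2 L)) → ℂ)).symm :
        (Finset (Orb (FermionTorus 2 L)) → ℂ) →ₗ[ℂ]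
          EuclideanSpace ℂ (Finset (Orb (FermionTorus 2 L)))) := rfl
  rw [hmap] at havgL
  exact UniqueGround.le_re_of_scalar_of_average E₀ A _
    (UniqueGround.exists_scalar_of_finrank_one E₀ hfin A) havgL hψE hunit

/-! ### The attractive mirror (Lieb's Theorem 1): `U < 0`, every doping -/

/-- **Average ⇒ every at every ATTRACTIVE coupling.** For `U < 0`, `δ ≥ 0` and `c > 0`: the crux's
hypothesis body at `U` (eventual ground-eigenspace average of `Δ_d† Δ_d` at least `c L⁴`) implies
the crux's conclusion body at `(U, δ)` (every admissible ground-state sequence has pair-field LRO),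
because Lieb's Theorem 1 makes the sector ground state simple at every even side
(`JosephsonMirror.eventualSimplicity_attractive`, from `lieb_attractive_holds`).
Lieb, PRL 62 (1989) 1201, Theorem 1. [cite: LiebPRL1989, Theorem 1] -/
theorem avgToEvery_attractive {U : ℝ} (hU : U < 0) {δ : ℝ} (hδ : 0 ≤ δ) {c : ℝ} (hc : 0 < c)
    (havg : ∃ L₀ : ℕ, ∀ (L : ℕ) [NeZero L], L₀ ≤ L → Even L →
      let N : ℕ := 2 * ⌊(1 - δ) * (L : ℝ) ^ 2 / 2⌋₊
      let H := hubbardTorus 2 L 1 U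
      let S := szSector (Λ := FermionTorus 2 L) N 0
      let E₀ := S ⊓ Module.End.eigenspace (Matrix.toLin' H) ((H.minEnergyOn S : ℝ) : ℂ)
      let P := projMatrix (E₀.map (Fock.toEuclidean (ι := Orb (FermionTorus 2 L)) :
        Fock (Orb (FermionTorus 2 L)) →ₗ[ℂ] EuclideanSpace ℂ (Finset (Orb (FermionTorus 2 L)))))
      c * (L : ℝ) ^ 4 * P.trace.re ≤
        (P * ((pairField dWaveFormFactor L)ᴴ * pairField dWaveFormFactor L)).trace.re) :
    ∀ (N : ℕ → ℕ) (ψ : ∀ L, Fock (Orb (FermionTorus 2 L))),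
      (∀ L, Even L → N L = 2 * ⌊(1 - δ) * (L : ℝ) ^ 2 / 2⌋₊ ∧ star (ψ L) ⬝ᵥ ψ L = 1 ∧
        IsGroundStateInSector (hubbardTorus 2 L 1 U) (N L) 0 (ψ L)) →
      HasLongRangeOrder (fun k => halfOpenBox 2 (2 * k))
        (fun k => torusPullback (pairFieldCorr dWaveFormFactor ψ) (2 * k)) :=
  avgToEvery_at_of_eventualSimplicity U δ c (by linarith) hc
    (JosephsonMirror.eventualSimplicity_attractive hU hδ) havg

/-- **THE ATTRACTIVE MIRROR OF CRUX 5, strong form.** The statement of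
`Theses.BalabanIR.BirEveryGroundState` with its repulsive window `0 < U₁ < U₂` replaced by an
attractive one `U₁ < U₂ < 0` — hypothesis and conclusion bodies verbatim — holds, and in fact at
EVERY coupling of the window (not only at some): Lieb's Theorem 1 supplies the ground-state
simplicity that the repulsive doped case lacks. Lieb, PRL 62 (1989) 1201, Theorem 1. [cite: LiebPRL1989, Theorem 1] -/
theorem birEveryGroundState_attractiveMirror_forall :
    ∀ (δ U₁ U₂ c : ℝ), δ ∈ Set.Ioo (0:ℝ) (1/2) → U₁ < U₂ → U₂ < 0 → 0 < c → (∀ U ∈ Set.Ioo U₁ U₂, ∃ L₀ : ℕ, ∀ (L : ℕ) [NeZero L], L₀ ≤ L → Even L → let N : ℕ := 2 * ⌊(1 - δ) * (L : ℝ) ^ 2 / 2⌋₊; let H := Literature.MathematicalPhysics.QuantumLattice.hubbardTorus 2 L 1 U; let S := Literature.MathematicalPhysics.QuantumLattice.szSector (Λ := Literature.MathematicalPhysics.QuantumLattice.FermionTorus 2 L) N 0; let E₀ := S ⊓ Module.End.eigenspace (Matrix.toLin' H) ((H.minEnergyOn S : ℝ) : ℂ); let P := Literature.MathematicalPhysics.QuantumLattice.projMatrix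 (E₀.map (Literature.MathematicalPhysics.QuantumLattice.Fock.toEuclidean (ι := Literature.MathematicalPhysics.QuantumLattice.Orb (Literature.MathematicalPhysics.QuantumLattice.FermionTorus 2 L)) : Literature.MathematicalPhysics.QuantumLattice.Fock (Literature.MathematicalPhysics.QuantumLattice.Orb (Literature.MathematicalPhysics.QuantumLattice.FermionTorus 2 L)) →ₗ[ℂ] EuclideanSpace ℂ (Finset (Literature.MathematicalPhysics.QuantumLattice.Orb (Literature.MathematicalPhysics.QuantumLattice.FermionTorus 2 L))))); c * (L : ℝ) ^ 4 * P.trace.re ≤ (P * (Matrix.conjTranspose (Literature.MathematicalPhysics.QuantumLattice.pairField Literature.MathematicalPhysics.QuantumLattice.dWaveFormFactor L) * Literature.MathematicalPhysics.QuantumLattice.pairField Literature.MathematicalPhysics.QuantumLattice.dWaveFormFactor L)).trace.re) → ∀ U ∈ Set.Ioo U₁ U₂, ∀ (N : ℕ → ℕ) (ψ : ∀ L, Literature.MathematicalPhysics.QuantumLattice.Fock (Literature.MathematicalPhysics.QuantumLattice.Orb (Literature.MathematicalPhysics.QuantumLattice.FermionTorus 2 L))), (∀ L, Even L → N L = 2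 * ⌊(1 - δ) * (L : ℝ) ^ 2 / 2⌋₊ ∧ star (ψ L) ⬝ᵥ ψ L = 1 ∧ Literature.MathematicalPhysics.QuantumLattice.IsGroundStateInSector (Literature.MathematicalPhysics.QuantumLattice.hubbardTorus 2 L 1 U) (N L) 0 (ψ L)) → Literature.Probability.LatticeModels.HasLongRangeOrder (fun k => Literature.Probability.LatticeModels.halfOpenBox 2 (2 * k)) (fun k => Literature.MathematicalPhysics.QuantumLattice.torusPullback (Literature.MathematicalPhysics.QuantumLattice.pairFieldCorr Literature.MathematicalPhysics.QuantumLattice.dWaveFormFactor ψ) (2 * k)) := by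
  intro δ U₁ U₂ c hδ _ hU₂ hc hyp U hU
  exact avgToEvery_attractive (lt_trans hU.2 hU₂) hδ.1.le hc (hyp U hU)

/-- **THE ATTRACTIVE MIRROR OF CRUX 5** (literal shape: `∃ U` in the window). The statement of
`Theses.BalabanIR.BirEveryGroundState` with `0 < U₁` replaced by `U₂ < 0`, everything else
verbatim, is a theorem (take the midpoint of the window in `birEveryGroundState_attractiveMirror_forall`).
Lieb, PRL 62 (1989) 1201, Theorem 1. [cite: LiebPRL1989, Theorem 1] -/
theorem birEveryGroundState_attractiveMirror :
    ∀ (δ U₁ U₂ c : ℝ), δ ∈ Set.Ioo (0:ℝ) (1/2) → U₁ < U₂ → U₂ < 0 → 0 < c → (∀ U ∈ Set.Ioo U₁ U₂, ∃ L₀ : ℕ, ∀ (L : ℕ) [NeZero L], L₀ ≤ L → Even L → let N : ℕ := 2 * ⌊(1 - δ) * (L : ℝ) ^ 2 / 2⌋₊; let H := Literature.MathematicalPhysics.QuantumLattice.hubbardTorus 2 L 1 U; let S := Literature.MathematicalPhysics.QuantumLattice.szSector (Λ := Literature.MathematicalPhysics.QuantumLattice.FermionTorus 2 L) N 0; let E₀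 := S ⊓ Module.End.eigenspace (Matrix.toLin' H) ((H.minEnergyOn S : ℝ) : ℂ); let P := Literature.MathematicalPhysics.QuantumLattice.projMatrix (E₀.map (Literature.MathematicalPhysics.QuantumLattice.Fock.toEuclidean (ι := Literature.MathematicalPhysics.QuantumLattice.Orb (Literature.MathematicalPhysics.QuantumLattice.FermionTorus 2 L)) : Literature.MathematicalPhysics.QuantumLattice.Fock (Literature.MathematicalPhysics.QuantumLattice.Orb (Literature.MathematicalPhysics.QuantumLattice.FermionTorus 2 L)) →ₗ[ℂ] EuclideanSpace ℂ (Finset (Literature.MathematicalPhysics.QuantumLattice.Orb (Literature.MathematicalPhysics.QuantumLattice.FermionTorus 2 L))))); c * (L : ℝ) ^ 4 * P.trace.re ≤ (P * (Matrix.conjTranspose (Literature.MathematicalPhysics.QuantumLattice.pairField Literature.MathematicalPhysics.QuantumLattice.dWaveFormFactor L) * Literature.MathematicalPhysics.QuantumLattice.pairField Literature.MathematicalPhysics.QuantumLattice.dWaveFormFactor L)).trace.re) → ∃ U ∈ Set.Ioo U₁ U₂, ∀ (N : ℕ → ℕ) (ψ : ∀ L, Literature.MathematicalPhysics.QuantumLattice.Fock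 (Literature.MathematicalPhysics.QuantumLattice.Orb (Literature.MathematicalPhysics.QuantumLattice.FermionTorus 2 L))), (∀ L, Even L → N L = 2 * ⌊(1 - δ) * (L : ℝ) ^ 2 / 2⌋₊ ∧ star (ψ L) ⬝ᵥ ψ L = 1 ∧ Literature.MathematicalPhysics.QuantumLattice.IsGroundStateInSector (Literature.MathematicalPhysics.QuantumLattice.hubbardTorus 2 L 1 U) (N L) 0 (ψ L)) → Literature.Probability.LatticeModels.HasLongRangeOrder (fun k => Literature.Probability.LatticeModels.halfOpenBox 2 (2 * k)) (fun k => Literature.MathematicalPhysics.QuantumLattice.torusPullback (Literature.MathematicalPhysics.QuantumLattice.pairFieldCorr Literature.MathematicalPhysics.QuantumLattice.dWaveFormFactor ψ) (2 * k)) := by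
  intro δ U₁ U₂ c hδ hU₁₂ hU₂ hc hyp
  have hU : (U₁ + U₂) / 2 ∈ Set.Ioo U₁ U₂ := ⟨by linarith, by linarith⟩
  exact ⟨_, hU, birEveryGroundState_attractiveMirror_forall δ U₁ U₂ c hδ hU₁₂ hU₂ hc hyp _ hU⟩

/-! ### The half-filled mirror (Lieb's Theorem 2): `δ = 0`, every `U > 0` -/

/-- **Average ⇒ every at HALF FILLING for every repulsive coupling.** For `U > 0` and `c > 0`, at
the endpoint `δ = 0` of the doping range (sector `(2⌊L²/2⌋, S^z = 0) = (L², 0)` at even `L`): the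
crux's hypothesis body at `U` implies its conclusion body at `(U, 0)`, because Lieb's Theorem 2 on
the balanced bipartite even torus makes the sector ground state simple at every even side `L ≥ 2`
(`JosephsonMirror.eventualSimplicity_halfFilling`, from `lieb_repulsive_halfFilling_holds`).
Lieb, PRL 62 (1989) 1201, Theorem 2. [cite: LiebPRL1989, Theorem 2] -/
theorem avgToEvery_halfFilling {U : ℝ} (hU : 0 < U) {c : ℝ} (hc : 0 < c)
    (havg : ∃ L₀ : ℕ, ∀ (L : ℕ) [NeZero L], L₀ ≤ L → Even L →
      let N : ℕ := 2 * ⌊(1 - 0) * (L : ℝ) ^ 2 / 2⌋₊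
      let H := hubbardTorus 2 L 1 U
      let S := szSector (Λ := FermionTorus 2 L) N 0
      let E₀ := S ⊓ Module.End.eigenspace (Matrix.toLin' H) ((H.minEnergyOn S : ℝ) : ℂ)
      let P := projMatrix (E₀.map (Fock.toEuclidean (ι := Orb (FermionTorus 2 L)) :
        Fock (Orb (FermionTorus 2 L)) →ₗ[ℂ] EuclideanSpace ℂ (Finset (Orb (FermionTorus 2 L)))))
      c * (L : ℝ) ^ 4 * P.trace.re ≤
        (P * ((pairField dWaveFormFactor L)ᴴ * pairField dWaveFormFactor L)).trace.re) :
    ∀ (N : ℕ → ℕ) (ψ : ∀ L, Fock (Orb (FermionTorus 2 L))),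
      (∀ L, Even L → N L = 2 * ⌊(1 - 0) * (L : ℝ) ^ 2 / 2⌋₊ ∧ star (ψ L) ⬝ᵥ ψ L = 1 ∧
        IsGroundStateInSector (hubbardTorus 2 L 1 U) (N L) 0 (ψ L)) →
      HasLongRangeOrder (fun k => halfOpenBox 2 (2 * k))
        (fun k => torusPullback (pairFieldCorr dWaveFormFactor ψ) (2 * k)) :=
  avgToEvery_at_of_eventualSimplicity U 0 c (by norm_num) hc
    (JosephsonMirror.eventualSimplicity_halfFilling hU) havg

/-- **THE HALF-FILLED MIRROR OF CRUX 5, strong form.** The statement of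
`Theses.BalabanIR.BirEveryGroundState` at the excluded endpoint `δ = 0` of its doping range —
repulsive window `0 < U₁ < U₂`, hypothesis and conclusion bodies verbatim with `δ := 0` — holds,
and at EVERY coupling of the window: Lieb's Theorem 2 supplies the ground-state simplicity that
the doped case lacks. Lieb, PRL 62 (1989) 1201, Theorem 2. [cite: LiebPRL1989, Theorem 2] -/
theorem birEveryGroundState_halfFillingMirror_forall :
    ∀ (U₁ U₂ c : ℝ), 0 < U₁ → U₁ < U₂ → 0 < c → (∀ U ∈ Set.Ioo U₁ U₂, ∃ L₀ : ℕ, ∀ (L : ℕ) [NeZero L], L₀ ≤ L → Even L → let N : ℕ := 2 * ⌊(1 - 0) * (L : ℝ) ^ 2 / 2⌋₊; let H := Literature.MathematicalPhysics.QuantumLattice.hubbardTorus 2 L 1 U; let S := Literature.MathematicalPhysics.QuantumLattice.szSector (Λ := Literature.MathematicalPhysics.QuantumLattice.FermionTorus 2 L) N 0; let E₀ := S ⊓ Module.End.eigenspace (Matrix.toLin' H) ((H.minEnergyOn S : ℝ) : ℂ); let P := Literature.MathematicalPhysics.QuantumLattice.projMatrix (E₀.map (Literature.MathematicalPhysics.QuantumLattice.Fock.toEuclidean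 (ι := Literature.MathematicalPhysics.QuantumLattice.Orb (Literature.MathematicalPhysics.QuantumLattice.FermionTorus 2 L)) : Literature.MathematicalPhysics.QuantumLattice.Fock (Literature.MathematicalPhysics.QuantumLattice.Orb (Literature.MathematicalPhysics.QuantumLattice.FermionTorus 2 L)) →ₗ[ℂ] EuclideanSpace ℂ (Finset (Literature.MathematicalPhysics.QuantumLattice.Orb (Literature.MathematicalPhysics.QuantumLattice.FermionTorus 2 L))))); c * (L : ℝ) ^ 4 * P.trace.re ≤ (P * (Matrix.conjTranspose (Literature.MathematicalPhysics.QuantumLattice.pairField Literature.MathematicalPhysics.QuantumLattice.dWaveFormFactor L) * Literature.MathematicalPhysics.QuantumLattice.pairField Literature.MathematicalPhysics.QuantumLattice.dWaveFormFactor L)).trace.re) → ∀ U ∈ Set.Ioo U₁ U₂, ∀ (N : ℕ → ℕ) (ψ : ∀ L, Literature.MathematicalPhysics.QuantumLattice.Fock (Literature.MathematicalPhysics.QuantumLattice.Orb (Literature.MathematicalPhysics.QuantumLattice.FermionTorus 2 L))), (∀ L, Even L → N L = 2 * ⌊(1 - 0) * (L : ℝ) ^ 2 / 2⌋₊ ∧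 star (ψ L) ⬝ᵥ ψ L = 1 ∧ Literature.MathematicalPhysics.QuantumLattice.IsGroundStateInSector (Literature.MathematicalPhysics.QuantumLattice.hubbardTorus 2 L 1 U) (N L) 0 (ψ L)) → Literature.Probability.LatticeModels.HasLongRangeOrder (fun k => Literature.Probability.LatticeModels.halfOpenBox 2 (2 * k)) (fun k => Literature.MathematicalPhysics.QuantumLattice.torusPullback (Literature.MathematicalPhysics.QuantumLattice.pairFieldCorr Literature.MathematicalPhysics.QuantumLattice.dWaveFormFactor ψ) (2 * k)) := by
  intro U₁ U₂ c hU₁ _ hc hyp U hU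
  exact avgToEvery_halfFilling (lt_trans hU₁ hU.1) hc (hyp U hU)

/-- **THE HALF-FILLED MIRROR OF CRUX 5** (literal shape: `∃ U` in the window). The statement of
`Theses.BalabanIR.BirEveryGroundState` specialised to `δ = 0` (outside its range `(0, 1/2)`, at the
endpoint), everything else verbatim, is a theorem for every repulsive window (midpoint in
`birEveryGroundState_halfFillingMirror_forall`). Together with the attractive mirror this calibrates
the crux on the accessible boundary of its quadrant `{U > 0} × {0 < δ < 1/2}`: TRUE on `{U < 0}` and
on `{δ = 0, U > 0}`; the interior is the open content. Lieb, PRL 62 (1989) 1201, Theorem 2.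
[cite: LiebPRL1989, Theorem 2] -/
theorem birEveryGroundState_halfFillingMirror :
    ∀ (U₁ U₂ c : ℝ), 0 < U₁ → U₁ < U₂ → 0 < c → (∀ U ∈ Set.Ioo U₁ U₂, ∃ L₀ : ℕ, ∀ (L : ℕ) [NeZero L], L₀ ≤ L → Even L → let N : ℕ := 2 * ⌊(1 - 0) * (L : ℝ) ^ 2 / 2⌋₊; let H := Literature.MathematicalPhysics.QuantumLattice.hubbardTorus 2 L 1 U; let S := Literature.MathematicalPhysics.QuantumLattice.szSector (Λ := Literature.MathematicalPhysics.QuantumLattice.FermionTorus 2 L) N 0; let E₀ := S ⊓ Module.End.eigenspace (Matrix.toLin' H) ((H.minEnergyOn S : ℝ) : ℂ); let P := Literature.MathematicalPhysics.QuantumLattice.projMatrix (E₀.map (Literature.MathematicalPhysics.QuantumLattice.Fock.toEuclidean (ι := Literature.MathematicalPhysics.QuantumLattice.Orb (Literature.MathematicalPhysics.QuantumLattice.FermionTorus 2 L)) : Literature.MathematicalPhysics.QuantumLattice.Fock (Literature.MathematicalPhysics.QuantumLattice.Orb (Literature.MathematicalPhysics.QuantumLattice.FermionTorus 2 L)) →ₗ[ℂ]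 EuclideanSpace ℂ (Finset (Literature.MathematicalPhysics.QuantumLattice.Orb (Literature.MathematicalPhysics.QuantumLattice.FermionTorus 2 L))))); c * (L : ℝ) ^ 4 * P.trace.re ≤ (P * (Matrix.conjTranspose (Literature.MathematicalPhysics.QuantumLattice.pairField Literature.MathematicalPhysics.QuantumLattice.dWaveFormFactor L) * Literature.MathematicalPhysics.QuantumLattice.pairField Literature.MathematicalPhysics.QuantumLattice.dWaveFormFactor L)).trace.re) → ∃ U ∈ Set.Ioo U₁ U₂, ∀ (N : ℕ → ℕ) (ψ : ∀ L, Literature.MathematicalPhysics.QuantumLattice.Fock (Literature.MathematicalPhysics.QuantumLattice.Orb (Literature.MathematicalPhysics.QuantumLattice.FermionTorus 2 L))), (∀ L, Even L → N L = 2 * ⌊(1 - 0) * (L : ℝ) ^ 2 / 2⌋₊ ∧ star (ψ L) ⬝ᵥ ψ L = 1 ∧ Literature.MathematicalPhysics.QuantumLattice.IsGroundStateInSector (Literature.MathematicalPhysics.QuantumLattice.hubbardTorus 2 L 1 U) (N L) 0 (ψ L)) → Literature.Probability.LatticeModels.HasLongRangeOrder (fun k => Literature.Probability.LatticeModels.halfOpenBox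 2 (2 * k)) (fun k => Literature.MathematicalPhysics.QuantumLattice.torusPullback (Literature.MathematicalPhysics.QuantumLattice.pairFieldCorr Literature.MathematicalPhysics.QuantumLattice.dWaveFormFactor ψ) (2 * k)) := by
  intro U₁ U₂ c hU₁ hU₁₂ hc hyp
  have hU : (U₁ + U₂) / 2 ∈ Set.Ioo U₁ U₂ := ⟨by linarith, by linarith⟩
  exact ⟨_, hU, birEveryGroundState_halfFillingMirror_forall U₁ U₂ c hU₁ hU₁₂ hc hyp _ hU⟩

end Summit.HubbardSuperconductivity.HubbardSuperconductivity.Theorems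

end
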